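/-
COR-CM (cell pub-hodgecm2, stage 2 of the Hodge ladder) — count-neutral KERNEL CENSUS TRANSPORT, degree 14, type ℤ/14 (seat
prover-pub-hodgecm2-b23-g35-0, binder prover b23, gen 35; claim DEG14-TRANSPORT = seat lit-andre-3ʼs sized ask A6-R37; sequel of
`CorCM/FaceCensusOrbitTransversal.lean`, `Census/TetradecicFaceGeneratorsCyclic.lean`,
`Census/TetradecicFaceTransportCyclicCerts.lean` (`sideChecks`) and `Census/TetradecicFaceTransportCyclicChecks.lean`
(`coverTrans`)). Theorems only: the generation binder, the non-vacuity of the face readings and the CLOSED field-closure theorems,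
from those kernel-checked side checks (used BY NAME). No definition, no named fact, nothing asserted; `Interfaces.lean` (C1),
every E term, B01 and `Transposition/*` are untouched. HONEST FRAMING (COORDINATOR RULING — HODGE FRAMING CORRECTION,
2026-08-21T11:55:35Z): `HC_CM` is NOT proved, here or anywhere in the tree. Every closing theorem below is CONDITIONAL on face-
period witnesses (for ONE field, on the nine listed faces); no period is proved here.
T5 (coordinator ruling 15:33:56Z (3)): the census binders of the transport are DISCHARGED in the kernel
(`Census/TetradecicFaceTransportCyclicCerts.lean`: `sideChecks`; `Census/TetradecicFaceTransportCyclicChecks.lean`: `coverTrans`); the dictionary binders (`e`, `hmul`, `hconj` / `ε`, `hε`,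
`c`) say «Gal(K/ℚ) ≅ ℤ/14 with complex conjugation ↦ 7» and are inhabited by every cyclic CM field of degree 14 (the intrinsic sequel
derives them from ONE generator); the face-reading binders are INHABITED IN THE KERNEL for every such enumeration
(`exists_faces_tetradecicCyclic` below, from `FaceCensus.exists_face_reads`); the only remaining hypotheses are the nine period witnesses on
the listed faces = instances of the crux (`FacePeriodExists` / B01-S), against which the tree has no `¬` theorem on the universe of record —
no contradiction derivable; checker: self (prover-pub-hodgecm2-b23-g35-0), 2026-08-21.
-/
import Summits.HodgeConjecture.CorCM.FaceCensusOrbitTransversal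
import Summits.HodgeConjecture.CorCM.Census.TetradecicFaceTransportCyclicCerts
import Summits.HodgeConjecture.CorCM.Census.TetradecicFaceTransportCyclicChecks
import HarnessLib

/-!
# Degree 14, cyclic type `ℤ/14`: nine face periods per field close its slice (census transport of lit-andre-3ʼs nine atoms)

Census transport instance (`FaceCensus.hgen_of_certOK_coverTrans`, `CorCM/FaceCensusOrbitTransversal.lean`) for the ONLY Galois CM
closure type of order 14, `(ℤ/14, c = 7)` — every cyclic CM field `K` of degree 14, e.g. the degree-14 subfields of `ℚ(ζ₄₃)`,
`ℚ(ζ₄₉)` — with the generating data of `Census/TetradecicFaceGeneratorsCyclic.lean`: the nine atom orbits of seat lit-andre-3ʼs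
`Census/TetradecicCyclicSpecies.lean` (`orbitRep`; minimal by its `nine_le_card_of_generates`, `μ(ℤ/14) = 9`) among the 48 square
orbits, represented by the faces `R₁ = (127; 129, 258)` … `R₉ = (5461; 129, 258)` (six on the `g`-interval type `{0,…,6}`, two on
`{0,2,3,4,5,6,8}`, one on the EVEN type `{0,2,…,12}` of the CM elliptic curve of `k ⊂ K`; carriers `B₀×B₅`, `B₀B₃B₅`, `B₀B₂B₅B₈`,
`B₀B₅B₆`, `B₀B₁B₅B₆`, `B₀B₂B₃B₅`, `B₂B₃B₄B₅`, `B₃B₅B₆B₇`, `E×B₆×B₇` in lit-andre-3ʼs labels). CONTENTS: the generation binder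
`hgen(𝒮, σ₀)` of INT2-GEN for every set `𝒮` of faces of a Galois CM field `K` of this type containing faces that READ AS the nine
generating representatives under an enumeration `e : GalT K ≃ Fin 14` of the table; non-vacuity of those readings; and the CLOSED
field-closure theorems on the universe of record — period witnesses on those nine faces ⟹ the Hodge conjecture, in every
codimension, for every complex abelian variety dominated by a finite product of abelian varieties realising CM types of CM fields
embeddable in `K` (products of powers of `E` and the nine simple CM sevenfolds split by `K`) — in the `GalT` form and in the
AUTOMORPHISM form (`ε : Aut(K) ≃ Fin 14`; bridge `FaceCensus.exists_enum_of_autEnum`). This is the degree-14 rung of the INT-2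
ladder `1 · (1,2,2,3,2,2) · 3 · (5,6,8,5) · 9` (degrees `6 · 8 · 10 · 12 · 14`). `HC_CM` is NOT proved and nothing here produces a
period.

References: [cite: Pohlmann1968, Thm. 1]; [cite: Milne1999LefschetzClasses, Thm. 3.2 and Cor. 4.5];
[cite: Shimura1998, §6.2 Theorem 3 and §6.1 Corollary of Theorem 2 (pp. 41–43)]; [cite: MumfordAV1970, §19 Thm. 1 and p. 169].
-/

noncomputable section

open CategoryTheory NumberField NumberField.ComplexEmbedding
open Literature.AlgebraicGeometry Literature.AlgebraicGeometry.Motives Literature.AlgebraicGeometry.HodgeTheory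
open Literature.AlgebraicGeometry.ComplexMultiplication Literature.AlgebraicGeometry.Milne1999
open Literature.NumberTheory.Automorphic
open Literature.NumberTheory.Automorphic.PicardCM
open Summit.HodgeConjecture.CorCM.Domination

namespace Summit.HodgeConjecture.CorCM.TetradecicFaceTransport.Cyclic

open Summit.HodgeConjecture.CorCM.Census.FaceSquaresModel (mem flipAt)
open Summit.HodgeConjecture.CorCM.Census.TetradecicFaceGeneratorsCyclic (Γ genReps certs)


/-- **The generation binder, type `ℤ/14` (cyclic tetradecic; `c = 7`).** `K` a Galois CM field with an enumeration `e : GalT K ≃ Fin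
14` of its Galois translates, multiplicative for b30's table and with `e conjT = 7`; `σ₀` a base embedding; `𝒮` any set of faces
of `K` containing faces READING AS the 9 generating representative codes `(127, 129, 258)` (type `{0,1,2,3,4,5,6}`, places
`{0,7}`, `{1,8}`), `(127, 129, 516)` (type `{0,1,2,3,4,5,6}`, places `{0,7}`, `{2,9}`), `(127, 258, 2064)` (type
`{0,1,2,3,4,5,6}`, places `{1,8}`, `{4,11}`), `(127, 258, 4128)` (type `{0,1,2,3,4,5,6}`, places `{1,8}`, `{5,12}`), `(127, 1032,
4128)` (type `{0,1,2,3,4,5,6}`, places `{3,10}`, `{5,12}`), `(127, 2064, 4128)` (type `{0,1,2,3,4,5,6}`, places `{4,11}`,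
`{5,12}`), `(381, 516, 8256)` (type `{0,2,3,4,5,6,8}`, places `{2,9}`, `{6,13}`), `(381, 1032, 8256)` (type `{0,2,3,4,5,6,8}`,
places `{3,10}`, `{6,13}`), `(5461, 129, 258)` (type `{0,2,4,6,8,10,12}`, places `{0,7}`, `{1,8}`) — `σ₀ ∘ P ∈ R.Φ ↔ e P ∈` the
type, `R.p`, `R.p′` at the two places. Then `hgen(𝒮, σ₀)` holds at every face (orbit-equivariant certificates of
`Census/TetradecicFaceGeneratorsCyclic.lean`, checked in `Census/TetradecicFaceTransportCyclicCerts.lean` / `…Checks.lean`: the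
nine atom orbits of lit-andre-3ʼs `TetradecicCyclicSpecies.orbitRep` among the 48 generate). [cite: Pohlmann1968, Thm. 1] [cite:
Milne1999LefschetzClasses, Thm. 3.2] -/
theorem hgen_tetradecicCyclic (K : CMField) [IsGalois ℚ K] (e : GalT K ≃ Fin 14)
    (hmul : ∀ P Q : GalT K, e (P * Q) = Γ.mul (e P) (e Q)) (hconj : e conjT = Γ.conj) (σ₀ : (K : Type) →+* ℂ)
    (𝒮 : Set (Face K))
    (h₁ : ∃ R ∈ 𝒮, (∀ P : GalT K, P.1 σ₀ ∈ R.Φ.1 ↔ mem (e P) 127 = true) ∧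
      Γ.placeMask (e (translate σ₀ R.p)) = 129 ∧ Γ.placeMask (e (translate σ₀ R.p')) = 258)
    (h₂ : ∃ R ∈ 𝒮, (∀ P : GalT K, P.1 σ₀ ∈ R.Φ.1 ↔ mem (e P) 127 = true) ∧
      Γ.placeMask (e (translate σ₀ R.p)) = 129 ∧ Γ.placeMask (e (translate σ₀ R.p')) = 516)
    (h₃ : ∃ R ∈ 𝒮, (∀ P : GalT K, P.1 σ₀ ∈ R.Φ.1 ↔ mem (e P) 127 = true) ∧
      Γ.placeMask (e (translate σ₀ R.p)) = 258 ∧ Γ.placeMask (e (translate σ₀ R.p')) = 2064)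
    (h₄ : ∃ R ∈ 𝒮, (∀ P : GalT K, P.1 σ₀ ∈ R.Φ.1 ↔ mem (e P) 127 = true) ∧
      Γ.placeMask (e (translate σ₀ R.p)) = 258 ∧ Γ.placeMask (e (translate σ₀ R.p')) = 4128)
    (h₅ : ∃ R ∈ 𝒮, (∀ P : GalT K, P.1 σ₀ ∈ R.Φ.1 ↔ mem (e P) 127 = true) ∧
      Γ.placeMask (e (translate σ₀ R.p)) = 1032 ∧ Γ.placeMask (e (translate σ₀ R.p')) = 4128)
    (h₆ : ∃ R ∈ 𝒮, (∀ P : GalT K, P.1 σ₀ ∈ R.Φ.1 ↔ mem (e P) 127 = true) ∧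
      Γ.placeMask (e (translate σ₀ R.p)) = 2064 ∧ Γ.placeMask (e (translate σ₀ R.p')) = 4128)
    (h₇ : ∃ R ∈ 𝒮, (∀ P : GalT K, P.1 σ₀ ∈ R.Φ.1 ↔ mem (e P) 381 = true) ∧
      Γ.placeMask (e (translate σ₀ R.p)) = 516 ∧ Γ.placeMask (e (translate σ₀ R.p')) = 8256)
    (h₈ : ∃ R ∈ 𝒮, (∀ P : GalT K, P.1 σ₀ ∈ R.Φ.1 ↔ mem (e P) 381 = true) ∧
      Γ.placeMask (e (translate σ₀ R.p)) = 1032 ∧ Γ.placeMask (e (translate σ₀ R.p')) = 8256)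
    (h₉ : ∃ R ∈ 𝒮, (∀ P : GalT K, P.1 σ₀ ∈ R.Φ.1 ↔ mem (e P) 5461 = true) ∧
      Γ.placeMask (e (translate σ₀ R.p)) = 129 ∧ Γ.placeMask (e (translate σ₀ R.p')) = 258) (f : Face K) :
    lefChar f.corner (fun _ => ({σ₀} : Finset ((K : Type) →+* ℂ))) ∈ AddSubgroup.closure
      {a : Asym K | ∃ g ∈ 𝒮, ∃ σ : (K : Type) →+* ℂ, a = lefChar g.corner (fun _ => ({σ} : Finset ((K : Type) →+* ℂ)))} := by
  refine FaceCensus.hgen_of_certOK_coverTrans Γ e hmul hconj genReps certs sideChecks.2.2.2 [127, 381, 635, 889, 1143, 1397, 1651, 2413, 2667, 5461] coverTrans.2.1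
    coverTrans.2.2 sideChecks.2.1 sideChecks.2.2.1 σ₀ 𝒮 ?_ f
  intro r hr
  have hr' : r = (127, 129, 258) ∨ r = (127, 129, 516) ∨ r = (127, 258, 2064) ∨ r = (127, 258, 4128) ∨ r = (127, 1032, 4128) ∨ r = (127, 2064, 4128) ∨ r = (381, 516, 8256) ∨ r = (381, 1032, 8256) ∨ r = (5461, 129, 258) := by simpa [genReps] using hr
  rcases hr' with rfl | rfl | rfl | rfl | rfl | rfl | rfl | rfl | rfl
  · obtain ⟨R, hRS, hΦ, hp, hq⟩ := h₁
    exact ⟨R, hRS, ⟨by decide, fun i => by rw [mem_pullType, hΦ, e.apply_symm_apply]⟩, hp, hq⟩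
  · obtain ⟨R, hRS, hΦ, hp, hq⟩ := h₂
    exact ⟨R, hRS, ⟨by decide, fun i => by rw [mem_pullType, hΦ, e.apply_symm_apply]⟩, hp, hq⟩
  · obtain ⟨R, hRS, hΦ, hp, hq⟩ := h₃
    exact ⟨R, hRS, ⟨by decide, fun i => by rw [mem_pullType, hΦ, e.apply_symm_apply]⟩, hp, hq⟩
  · obtain ⟨R, hRS, hΦ, hp, hq⟩ := h₄
    exact ⟨R, hRS, ⟨by decide, fun i => by rw [mem_pullType, hΦ, e.apply_symm_apply]⟩, hp, hq⟩
  · obtain ⟨R, hRS, hΦ, hp, hq⟩ := h₅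
    exact ⟨R, hRS, ⟨by decide, fun i => by rw [mem_pullType, hΦ, e.apply_symm_apply]⟩, hp, hq⟩
  · obtain ⟨R, hRS, hΦ, hp, hq⟩ := h₆
    exact ⟨R, hRS, ⟨by decide, fun i => by rw [mem_pullType, hΦ, e.apply_symm_apply]⟩, hp, hq⟩
  · obtain ⟨R, hRS, hΦ, hp, hq⟩ := h₇
    exact ⟨R, hRS, ⟨by decide, fun i => by rw [mem_pullType, hΦ, e.apply_symm_apply]⟩, hp, hq⟩
  · obtain ⟨R, hRS, hΦ, hp, hq⟩ := h₈
    exact ⟨R, hRS, ⟨by decide, fun i => by rw [mem_pullType, hΦ, e.apply_symm_apply]⟩, hp, hq⟩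
  · obtain ⟨R, hRS, hΦ, hp, hq⟩ := h₉
    exact ⟨R, hRS, ⟨by decide, fun i => by rw [mem_pullType, hΦ, e.apply_symm_apply]⟩, hp, hq⟩

set_option maxRecDepth 100000 in -- `List.range (2 ^ 14)` in the kernel
/-- **Non-vacuity, type `ℤ/14` (cyclic tetradecic; `c = 7`):** under any such enumeration, faces of `K` reading as the generating
representative codes EXIST (`FaceCensus.exists_face_reads`; the codes lie in `Γ.faces` by `decide`). [folklore] -/
theorem exists_faces_tetradecicCyclic (K : CMField) [IsGalois ℚ K] (e : GalT K ≃ Fin 14)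
    (hmul : ∀ P Q : GalT K, e (P * Q) = Γ.mul (e P) (e Q)) (hconj : e conjT = Γ.conj) (σ₀ : (K : Type) →+* ℂ) :
    ∃ R₁ R₂ R₃ R₄ R₅ R₆ R₇ R₈ R₉ : Face K,
      ((∀ P : GalT K, P.1 σ₀ ∈ R₁.Φ.1 ↔ mem (e P) 127 = true) ∧
      Γ.placeMask (e (translate σ₀ R₁.p)) = 129 ∧ Γ.placeMask (e (translate σ₀ R₁.p')) = 258) ∧
      ((∀ P : GalT K, P.1 σ₀ ∈ R₂.Φ.1 ↔ mem (e P) 127 = true) ∧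
      Γ.placeMask (e (translate σ₀ R₂.p)) = 129 ∧ Γ.placeMask (e (translate σ₀ R₂.p')) = 516) ∧
      ((∀ P : GalT K, P.1 σ₀ ∈ R₃.Φ.1 ↔ mem (e P) 127 = true) ∧
      Γ.placeMask (e (translate σ₀ R₃.p)) = 258 ∧ Γ.placeMask (e (translate σ₀ R₃.p')) = 2064) ∧
      ((∀ P : GalT K, P.1 σ₀ ∈ R₄.Φ.1 ↔ mem (e P) 127 = true) ∧
      Γ.placeMask (e (translate σ₀ R₄.p)) = 258 ∧ Γ.placeMask (e (translate σ₀ R₄.p')) = 4128) ∧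
      ((∀ P : GalT K, P.1 σ₀ ∈ R₅.Φ.1 ↔ mem (e P) 127 = true) ∧
      Γ.placeMask (e (translate σ₀ R₅.p)) = 1032 ∧ Γ.placeMask (e (translate σ₀ R₅.p')) = 4128) ∧
      ((∀ P : GalT K, P.1 σ₀ ∈ R₆.Φ.1 ↔ mem (e P) 127 = true) ∧
      Γ.placeMask (e (translate σ₀ R₆.p)) = 2064 ∧ Γ.placeMask (e (translate σ₀ R₆.p')) = 4128) ∧
      ((∀ P : GalT K, P.1 σ₀ ∈ R₇.Φ.1 ↔ mem (e P) 381 = true) ∧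
      Γ.placeMask (e (translate σ₀ R₇.p)) = 516 ∧ Γ.placeMask (e (translate σ₀ R₇.p')) = 8256) ∧
      ((∀ P : GalT K, P.1 σ₀ ∈ R₈.Φ.1 ↔ mem (e P) 381 = true) ∧
      Γ.placeMask (e (translate σ₀ R₈.p)) = 1032 ∧ Γ.placeMask (e (translate σ₀ R₈.p')) = 8256) ∧
      ((∀ P : GalT K, P.1 σ₀ ∈ R₉.Φ.1 ↔ mem (e P) 5461 = true) ∧
      Γ.placeMask (e (translate σ₀ R₉.p)) = 129 ∧ Γ.placeMask (e (translate σ₀ R₉.p')) = 258) := by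
  obtain ⟨R₁, hT₁, hp₁, hq₁⟩ := FaceCensus.exists_face_reads Γ e hmul hconj σ₀ (r := (127, 129, 258))
    (by decide +kernel)
  obtain ⟨R₂, hT₂, hp₂, hq₂⟩ := FaceCensus.exists_face_reads Γ e hmul hconj σ₀ (r := (127, 129, 516))
    (by decide +kernel)
  obtain ⟨R₃, hT₃, hp₃, hq₃⟩ := FaceCensus.exists_face_reads Γ e hmul hconj σ₀ (r := (127, 258, 2064))
    (by decide +kernel)
  obtain ⟨R₄, hT₄, hp₄, hq₄⟩ := FaceCensus.exists_face_reads Γ e hmul hconj σ₀ (r := (127, 258, 4128))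
    (by decide +kernel)
  obtain ⟨R₅, hT₅, hp₅, hq₅⟩ := FaceCensus.exists_face_reads Γ e hmul hconj σ₀ (r := (127, 1032, 4128))
    (by decide +kernel)
  obtain ⟨R₆, hT₆, hp₆, hq₆⟩ := FaceCensus.exists_face_reads Γ e hmul hconj σ₀ (r := (127, 2064, 4128))
    (by decide +kernel)
  obtain ⟨R₇, hT₇, hp₇, hq₇⟩ := FaceCensus.exists_face_reads Γ e hmul hconj σ₀ (r := (381, 516, 8256))
    (by decide +kernel)
  obtain ⟨R₈, hT₈, hp₈, hq₈⟩ := FaceCensus.exists_face_reads Γ e hmul hconj σ₀ (r := (381, 1032, 8256))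
    (by decide +kernel)
  obtain ⟨R₉, hT₉, hp₉, hq₉⟩ := FaceCensus.exists_face_reads Γ e hmul hconj σ₀ (r := (5461, 129, 258))
    (by decide +kernel)
  exact ⟨R₁, R₂, R₃, R₄, R₅, R₆, R₇, R₈, R₉, ⟨fun P => by rw [← mem_pullType, ← e.symm_apply_apply P, ← hT₁.2 (e P), e.symm_apply_apply],
    hp₁, hq₁⟩, ⟨fun P => by rw [← mem_pullType, ← e.symm_apply_apply P, ← hT₂.2 (e P), e.symm_apply_apply],
    hp₂, hq₂⟩, ⟨fun P => by rw [← mem_pullType, ← e.symm_apply_apply P, ← hT₃.2 (e P), e.symm_apply_apply],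
    hp₃, hq₃⟩, ⟨fun P => by rw [← mem_pullType, ← e.symm_apply_apply P, ← hT₄.2 (e P), e.symm_apply_apply],
    hp₄, hq₄⟩, ⟨fun P => by rw [← mem_pullType, ← e.symm_apply_apply P, ← hT₅.2 (e P), e.symm_apply_apply],
    hp₅, hq₅⟩, ⟨fun P => by rw [← mem_pullType, ← e.symm_apply_apply P, ← hT₆.2 (e P), e.symm_apply_apply],
    hp₆, hq₆⟩, ⟨fun P => by rw [← mem_pullType, ← e.symm_apply_apply P, ← hT₇.2 (e P), e.symm_apply_apply],
    hp₇, hq₇⟩, ⟨fun P => by rw [← mem_pullType, ← e.symm_apply_apply P, ← hT₈.2 (e P), e.symm_apply_apply],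
    hp₈, hq₈⟩, ⟨fun P => by rw [← mem_pullType, ← e.symm_apply_apply P, ← hT₉.2 (e P), e.symm_apply_apply],
    hp₉, hq₉⟩⟩

/-- **FIELD CLOSURE, type `ℤ/14` (cyclic tetradecic; `c = 7`) — period-witness form, CLOSED (headline).** `K`, `e`, `σ₀` as above and
9 faces of `K` reading as the generating representatives; ONE period witness for each on the universe of record (some admissible
`ι₁`, some hermitian 3-space, some level, eigenforms at some `σ`) implies the Hodge conjecture, in every codimension, for every
complex abelian variety dominated by a finite product of abelian varieties realising CM types of CM fields embeddable in `K`.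
(FRAMING: conditional on these 9 face periods; `HC_CM` is not proved.) [cite: Shimura1998, §6.2 Theorem 3 and §6.1 Corollary of
Theorem 2 (pp. 41–43)] [cite: Pohlmann1968, Thm. 1] [cite: Milne1999LefschetzClasses, Thm. 3.2 and Cor. 4.5] [cite: MumfordAV1970,
§19 Thm. 1 and p. 169] -/
theorem hodgeConjectureFor_of_avDominatedBy_isProductOf_of_facePeriod_tetradecicCyclic (K : CMField) [IsGalois ℚ K]
    (e : GalT K ≃ Fin 14) (hmul : ∀ P Q : GalT K, e (P * Q) = Γ.mul (e P) (e Q)) (hconj : e conjT = Γ.conj)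
    (σ₀ : (K : Type) →+* ℂ) (R₁ R₂ R₃ R₄ R₅ R₆ R₇ R₈ R₉ : Face K)
    (hR₁ : (∀ P : GalT K, P.1 σ₀ ∈ R₁.Φ.1 ↔ mem (e P) 127 = true) ∧
      Γ.placeMask (e (translate σ₀ R₁.p)) = 129 ∧ Γ.placeMask (e (translate σ₀ R₁.p')) = 258)
    (hR₂ : (∀ P : GalT K, P.1 σ₀ ∈ R₂.Φ.1 ↔ mem (e P) 127 = true) ∧
      Γ.placeMask (e (translate σ₀ R₂.p)) = 129 ∧ Γ.placeMask (e (translate σ₀ R₂.p')) = 516)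
    (hR₃ : (∀ P : GalT K, P.1 σ₀ ∈ R₃.Φ.1 ↔ mem (e P) 127 = true) ∧
      Γ.placeMask (e (translate σ₀ R₃.p)) = 258 ∧ Γ.placeMask (e (translate σ₀ R₃.p')) = 2064)
    (hR₄ : (∀ P : GalT K, P.1 σ₀ ∈ R₄.Φ.1 ↔ mem (e P) 127 = true) ∧
      Γ.placeMask (e (translate σ₀ R₄.p)) = 258 ∧ Γ.placeMask (e (translate σ₀ R₄.p')) = 4128)
    (hR₅ : (∀ P : GalT K, P.1 σ₀ ∈ R₅.Φ.1 ↔ mem (e P) 127 = true) ∧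
      Γ.placeMask (e (translate σ₀ R₅.p)) = 1032 ∧ Γ.placeMask (e (translate σ₀ R₅.p')) = 4128)
    (hR₆ : (∀ P : GalT K, P.1 σ₀ ∈ R₆.Φ.1 ↔ mem (e P) 127 = true) ∧
      Γ.placeMask (e (translate σ₀ R₆.p)) = 2064 ∧ Γ.placeMask (e (translate σ₀ R₆.p')) = 4128)
    (hR₇ : (∀ P : GalT K, P.1 σ₀ ∈ R₇.Φ.1 ↔ mem (e P) 381 = true) ∧
      Γ.placeMask (e (translate σ₀ R₇.p)) = 516 ∧ Γ.placeMask (e (translate σ₀ R₇.p')) = 8256)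
    (hR₈ : (∀ P : GalT K, P.1 σ₀ ∈ R₈.Φ.1 ↔ mem (e P) 381 = true) ∧
      Γ.placeMask (e (translate σ₀ R₈.p)) = 1032 ∧ Γ.placeMask (e (translate σ₀ R₈.p')) = 8256)
    (hR₉ : (∀ P : GalT K, P.1 σ₀ ∈ R₉.Φ.1 ↔ mem (e P) 5461 = true) ∧
      Γ.placeMask (e (translate σ₀ R₉.p)) = 129 ∧ Γ.placeMask (e (translate σ₀ R₉.p')) = 258)
    (h₁ : ∃ ι₁ : K →+* ℂ, R₁.Admissible ι₁ ∧ ∃ (V : HermSpace3 K ι₁) (σ : K →+* ℂ),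
      (Model.picardCMUniverse exists_isReal_hodgeModel_holds hodgePQ_independent_of_hodgeModel_holds
        BallQuotient.ballQuotientUniformised_holds cmAbelianVarietyRealised_holds).PeriodNV ι₁ V K R₁.psi σ)
    (h₂ : ∃ ι₁ : K →+* ℂ, R₂.Admissible ι₁ ∧ ∃ (V : HermSpace3 K ι₁) (σ : K →+* ℂ),
      (Model.picardCMUniverse exists_isReal_hodgeModel_holds hodgePQ_independent_of_hodgeModel_holds
        BallQuotient.ballQuotientUniformised_holds cmAbelianVarietyRealised_holds).PeriodNV ι₁ V K R₂.psi σ)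
    (h₃ : ∃ ι₁ : K →+* ℂ, R₃.Admissible ι₁ ∧ ∃ (V : HermSpace3 K ι₁) (σ : K →+* ℂ),
      (Model.picardCMUniverse exists_isReal_hodgeModel_holds hodgePQ_independent_of_hodgeModel_holds
        BallQuotient.ballQuotientUniformised_holds cmAbelianVarietyRealised_holds).PeriodNV ι₁ V K R₃.psi σ)
    (h₄ : ∃ ι₁ : K →+* ℂ, R₄.Admissible ι₁ ∧ ∃ (V : HermSpace3 K ι₁) (σ : K →+* ℂ),
      (Model.picardCMUniverse exists_isReal_hodgeModel_holds hodgePQ_independent_of_hodgeModel_holds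
        BallQuotient.ballQuotientUniformised_holds cmAbelianVarietyRealised_holds).PeriodNV ι₁ V K R₄.psi σ)
    (h₅ : ∃ ι₁ : K →+* ℂ, R₅.Admissible ι₁ ∧ ∃ (V : HermSpace3 K ι₁) (σ : K →+* ℂ),
      (Model.picardCMUniverse exists_isReal_hodgeModel_holds hodgePQ_independent_of_hodgeModel_holds
        BallQuotient.ballQuotientUniformised_holds cmAbelianVarietyRealised_holds).PeriodNV ι₁ V K R₅.psi σ)
    (h₆ : ∃ ι₁ : K →+* ℂ, R₆.Admissible ι₁ ∧ ∃ (V : HermSpace3 K ι₁) (σ : K →+* ℂ),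
      (Model.picardCMUniverse exists_isReal_hodgeModel_holds hodgePQ_independent_of_hodgeModel_holds
        BallQuotient.ballQuotientUniformised_holds cmAbelianVarietyRealised_holds).PeriodNV ι₁ V K R₆.psi σ)
    (h₇ : ∃ ι₁ : K →+* ℂ, R₇.Admissible ι₁ ∧ ∃ (V : HermSpace3 K ι₁) (σ : K →+* ℂ),
      (Model.picardCMUniverse exists_isReal_hodgeModel_holds hodgePQ_independent_of_hodgeModel_holds
        BallQuotient.ballQuotientUniformised_holds cmAbelianVarietyRealised_holds).PeriodNV ι₁ V K R₇.psi σ)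
    (h₈ : ∃ ι₁ : K →+* ℂ, R₈.Admissible ι₁ ∧ ∃ (V : HermSpace3 K ι₁) (σ : K →+* ℂ),
      (Model.picardCMUniverse exists_isReal_hodgeModel_holds hodgePQ_independent_of_hodgeModel_holds
        BallQuotient.ballQuotientUniformised_holds cmAbelianVarietyRealised_holds).PeriodNV ι₁ V K R₈.psi σ)
    (h₉ : ∃ ι₁ : K →+* ℂ, R₉.Admissible ι₁ ∧ ∃ (V : HermSpace3 K ι₁) (σ : K →+* ℂ),
      (Model.picardCMUniverse exists_isReal_hodgeModel_holds hodgePQ_independent_of_hodgeModel_holds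
        BallQuotient.ballQuotientUniformised_holds cmAbelianVarietyRealised_holds).PeriodNV ι₁ V K R₉.psi σ)
    {P A : AbelianVariety ℂ} (hP : AbelianVariety.IsProductOf (fun B : AbelianVariety ℂ =>
      ∃ (E : Type) (_ : Field E) (_ : NumberField E) (_ : IsCMField E) (_ : E →+* (K : Type)) (Φ : CMType E)
        (ι : 𝓞 E →+* End B) (θ : E →+* Module.End ℂ (complexBetti B.X 1)),
        IsCMTypeRealisation Φ B ι θ) P)
    (hA : AVDominatedBy A P) : HodgeConjectureFor A.dim A.X :=
  hodgeConjectureFor_of_avDominatedBy_isProductOf_of_exists_facePeriod_on K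
    ((show 6 ≤ 14 by decide).trans_eq (FaceCensus.eq_finrank_of_enum e)) {R₁, R₂, R₃, R₄, R₅, R₆, R₇, R₈, R₉} σ₀
    (hgen_tetradecicCyclic K e hmul hconj σ₀ {R₁, R₂, R₃, R₄, R₅, R₆, R₇, R₈, R₉} ⟨R₁, by simp, hR₁⟩ ⟨R₂, by simp, hR₂⟩ ⟨R₃, by simp, hR₃⟩ ⟨R₄, by simp, hR₄⟩ ⟨R₅, by simp, hR₅⟩ ⟨R₆, by simp, hR₆⟩ ⟨R₇, by simp, hR₇⟩ ⟨R₈, by simp, hR₈⟩ ⟨R₉, by simp, hR₉⟩)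
    (fun f hf => by
      simp only [Set.mem_insert_iff, Set.mem_singleton_iff] at hf
      rcases hf with rfl | rfl | rfl | rfl | rfl | rfl | rfl | rfl | rfl
      · exact h₁
      · exact h₂
      · exact h₃
      · exact h₄
      · exact h₅
      · exact h₆
      · exact h₇
      · exact h₈
      · exact h₉) hP hA


/-- **FIELD CLOSURE, type `ℤ/14` (cyclic tetradecic; `c = 7`) — from AUTOMORPHISM data (the form a field-specific seat has).** Same
conclusion with the dictionary given on `Aut(K)`: a base embedding `σ₀`, a bijection `ε : Aut(K) ≃ Fin 14` multiplicative for
b30's table, the automorphism `c` inducing complex conjugation at `σ₀` with `ε c = 7`, and the faces described through `ε` (`σ₀ ∘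
g ∈ Rᵢ.Φ ↔ ε g ∈` type mask; place representatives `σ₀ ∘ g_p`, `σ₀ ∘ g_q` with the listed place masks). The enumeration of `GalT
K` is produced by `FaceCensus.exists_enum_of_autEnum` (`CorCM/FaceCensusCells.lean`). (FRAMING: conditional on the face periods;
`HC_CM` is not proved.) [cite: Shimura1998, §6.2 Theorem 3 and §6.1 Corollary of Theorem 2 (pp. 41–43)] [cite: Pohlmann1968, Thm.
1] [cite: Milne1999LefschetzClasses, Thm. 3.2 and Cor. 4.5] [cite: MumfordAV1970, §19 Thm. 1 and p. 169] -/
theorem hodgeConjectureFor_of_avDominatedBy_isProductOf_of_facePeriod_tetradecicCyclic_aut (K : CMField) [IsGalois ℚ K]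
    (σ₀ : (K : Type) →+* ℂ) (ε : ((K : Type) ≃ₐ[ℚ] (K : Type)) ≃ Fin 14)
    (hε : ∀ g h : ((K : Type) ≃ₐ[ℚ] (K : Type)), ε (g * h) = Γ.mul (ε g) (ε h))
    (c : ((K : Type) ≃ₐ[ℚ] (K : Type))) (hc : σ₀.comp (c : (K : Type) →+* (K : Type)) = conjugate σ₀) (hεc : ε c = Γ.conj)
    (R₁ R₂ R₃ R₄ R₅ R₆ R₇ R₈ R₉ : Face K) (g₁ g₁' : ((K : Type) ≃ₐ[ℚ] (K : Type))) (g₂ g₂' : ((K : Type) ≃ₐ[ℚ] (K : Type))) (g₃ g₃' : ((K : Type) ≃ₐ[ℚ] (K : Type))) (g₄ g₄' : ((K : Type) ≃ₐ[ℚ] (K : Type))) (g₅ g₅' : ((K : Type) ≃ₐ[ℚ] (K : Type))) (g₆ g₆' : ((K : Type) ≃ₐ[ℚ] (K : Type))) (g₇ g₇' : ((K : Type) ≃ₐ[ℚ] (K : Type))) (g₈ g₈' : ((K : Type) ≃ₐ[ℚ] (K : Type))) (g₉ g₉' : ((K : Type) ≃ₐ[ℚ] (K : Type)))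
    (hΦ₁ : ∀ g : ((K : Type) ≃ₐ[ℚ] (K : Type)),
      σ₀.comp (g : (K : Type) →+* (K : Type)) ∈ R₁.Φ.1 ↔ mem (ε g) 127 = true)
    (hp₁ : R₁.p = σ₀.comp (g₁ : (K : Type) →+* (K : Type))) (hp₁' : Γ.placeMask (ε g₁) = 129)
    (hq₁ : R₁.p' = σ₀.comp (g₁' : (K : Type) →+* (K : Type))) (hq₁' : Γ.placeMask (ε g₁') = 258)
    (hΦ₂ : ∀ g : ((K : Type) ≃ₐ[ℚ] (K : Type)),
      σ₀.comp (g : (K : Type) →+* (K : Type)) ∈ R₂.Φ.1 ↔ mem (ε g) 127 = true)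
    (hp₂ : R₂.p = σ₀.comp (g₂ : (K : Type) →+* (K : Type))) (hp₂' : Γ.placeMask (ε g₂) = 129)
    (hq₂ : R₂.p' = σ₀.comp (g₂' : (K : Type) →+* (K : Type))) (hq₂' : Γ.placeMask (ε g₂') = 516)
    (hΦ₃ : ∀ g : ((K : Type) ≃ₐ[ℚ] (K : Type)),
      σ₀.comp (g : (K : Type) →+* (K : Type)) ∈ R₃.Φ.1 ↔ mem (ε g) 127 = true)
    (hp₃ : R₃.p = σ₀.comp (g₃ : (K : Type) →+* (K : Type))) (hp₃' : Γ.placeMask (ε g₃) = 258)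
    (hq₃ : R₃.p' = σ₀.comp (g₃' : (K : Type) →+* (K : Type))) (hq₃' : Γ.placeMask (ε g₃') = 2064)
    (hΦ₄ : ∀ g : ((K : Type) ≃ₐ[ℚ] (K : Type)),
      σ₀.comp (g : (K : Type) →+* (K : Type)) ∈ R₄.Φ.1 ↔ mem (ε g) 127 = true)
    (hp₄ : R₄.p = σ₀.comp (g₄ : (K : Type) →+* (K : Type))) (hp₄' : Γ.placeMask (ε g₄) = 258)
    (hq₄ : R₄.p' = σ₀.comp (g₄' : (K : Type) →+* (K : Type))) (hq₄' : Γ.placeMask (ε g₄') = 4128)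
    (hΦ₅ : ∀ g : ((K : Type) ≃ₐ[ℚ] (K : Type)),
      σ₀.comp (g : (K : Type) →+* (K : Type)) ∈ R₅.Φ.1 ↔ mem (ε g) 127 = true)
    (hp₅ : R₅.p = σ₀.comp (g₅ : (K : Type) →+* (K : Type))) (hp₅' : Γ.placeMask (ε g₅) = 1032)
    (hq₅ : R₅.p' = σ₀.comp (g₅' : (K : Type) →+* (K : Type))) (hq₅' : Γ.placeMask (ε g₅') = 4128)
    (hΦ₆ : ∀ g : ((K : Type) ≃ₐ[ℚ] (K : Type)),
      σ₀.comp (g : (K : Type) →+* (K : Type)) ∈ R₆.Φ.1 ↔ mem (ε g) 127 = true)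
    (hp₆ : R₆.p = σ₀.comp (g₆ : (K : Type) →+* (K : Type))) (hp₆' : Γ.placeMask (ε g₆) = 2064)
    (hq₆ : R₆.p' = σ₀.comp (g₆' : (K : Type) →+* (K : Type))) (hq₆' : Γ.placeMask (ε g₆') = 4128)
    (hΦ₇ : ∀ g : ((K : Type) ≃ₐ[ℚ] (K : Type)),
      σ₀.comp (g : (K : Type) →+* (K : Type)) ∈ R₇.Φ.1 ↔ mem (ε g) 381 = true)
    (hp₇ : R₇.p = σ₀.comp (g₇ : (K : Type) →+* (K : Type))) (hp₇' : Γ.placeMask (ε g₇) = 516)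
    (hq₇ : R₇.p' = σ₀.comp (g₇' : (K : Type) →+* (K : Type))) (hq₇' : Γ.placeMask (ε g₇') = 8256)
    (hΦ₈ : ∀ g : ((K : Type) ≃ₐ[ℚ] (K : Type)),
      σ₀.comp (g : (K : Type) →+* (K : Type)) ∈ R₈.Φ.1 ↔ mem (ε g) 381 = true)
    (hp₈ : R₈.p = σ₀.comp (g₈ : (K : Type) →+* (K : Type))) (hp₈' : Γ.placeMask (ε g₈) = 1032)
    (hq₈ : R₈.p' = σ₀.comp (g₈' : (K : Type) →+* (K : Type))) (hq₈' : Γ.placeMask (ε g₈') = 8256)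
    (hΦ₉ : ∀ g : ((K : Type) ≃ₐ[ℚ] (K : Type)),
      σ₀.comp (g : (K : Type) →+* (K : Type)) ∈ R₉.Φ.1 ↔ mem (ε g) 5461 = true)
    (hp₉ : R₉.p = σ₀.comp (g₉ : (K : Type) →+* (K : Type))) (hp₉' : Γ.placeMask (ε g₉) = 129)
    (hq₉ : R₉.p' = σ₀.comp (g₉' : (K : Type) →+* (K : Type))) (hq₉' : Γ.placeMask (ε g₉') = 258)
    (h₁ : ∃ ι₁ : K →+* ℂ, R₁.Admissible ι₁ ∧ ∃ (V : HermSpace3 K ι₁) (σ : K →+* ℂ),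
      (Model.picardCMUniverse exists_isReal_hodgeModel_holds hodgePQ_independent_of_hodgeModel_holds
        BallQuotient.ballQuotientUniformised_holds cmAbelianVarietyRealised_holds).PeriodNV ι₁ V K R₁.psi σ)
    (h₂ : ∃ ι₁ : K →+* ℂ, R₂.Admissible ι₁ ∧ ∃ (V : HermSpace3 K ι₁) (σ : K →+* ℂ),
      (Model.picardCMUniverse exists_isReal_hodgeModel_holds hodgePQ_independent_of_hodgeModel_holds
        BallQuotient.ballQuotientUniformised_holds cmAbelianVarietyRealised_holds).PeriodNV ι₁ V K R₂.psi σ)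
    (h₃ : ∃ ι₁ : K →+* ℂ, R₃.Admissible ι₁ ∧ ∃ (V : HermSpace3 K ι₁) (σ : K →+* ℂ),
      (Model.picardCMUniverse exists_isReal_hodgeModel_holds hodgePQ_independent_of_hodgeModel_holds
        BallQuotient.ballQuotientUniformised_holds cmAbelianVarietyRealised_holds).PeriodNV ι₁ V K R₃.psi σ)
    (h₄ : ∃ ι₁ : K →+* ℂ, R₄.Admissible ι₁ ∧ ∃ (V : HermSpace3 K ι₁) (σ : K →+* ℂ),
      (Model.picardCMUniverse exists_isReal_hodgeModel_holds hodgePQ_independent_of_hodgeModel_holds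
        BallQuotient.ballQuotientUniformised_holds cmAbelianVarietyRealised_holds).PeriodNV ι₁ V K R₄.psi σ)
    (h₅ : ∃ ι₁ : K →+* ℂ, R₅.Admissible ι₁ ∧ ∃ (V : HermSpace3 K ι₁) (σ : K →+* ℂ),
      (Model.picardCMUniverse exists_isReal_hodgeModel_holds hodgePQ_independent_of_hodgeModel_holds
        BallQuotient.ballQuotientUniformised_holds cmAbelianVarietyRealised_holds).PeriodNV ι₁ V K R₅.psi σ)
    (h₆ : ∃ ι₁ : K →+* ℂ, R₆.Admissible ι₁ ∧ ∃ (V : HermSpace3 K ι₁) (σ : K →+* ℂ),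
      (Model.picardCMUniverse exists_isReal_hodgeModel_holds hodgePQ_independent_of_hodgeModel_holds
        BallQuotient.ballQuotientUniformised_holds cmAbelianVarietyRealised_holds).PeriodNV ι₁ V K R₆.psi σ)
    (h₇ : ∃ ι₁ : K →+* ℂ, R₇.Admissible ι₁ ∧ ∃ (V : HermSpace3 K ι₁) (σ : K →+* ℂ),
      (Model.picardCMUniverse exists_isReal_hodgeModel_holds hodgePQ_independent_of_hodgeModel_holds
        BallQuotient.ballQuotientUniformised_holds cmAbelianVarietyRealised_holds).PeriodNV ι₁ V K R₇.psi σ)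
    (h₈ : ∃ ι₁ : K →+* ℂ, R₈.Admissible ι₁ ∧ ∃ (V : HermSpace3 K ι₁) (σ : K →+* ℂ),
      (Model.picardCMUniverse exists_isReal_hodgeModel_holds hodgePQ_independent_of_hodgeModel_holds
        BallQuotient.ballQuotientUniformised_holds cmAbelianVarietyRealised_holds).PeriodNV ι₁ V K R₈.psi σ)
    (h₉ : ∃ ι₁ : K →+* ℂ, R₉.Admissible ι₁ ∧ ∃ (V : HermSpace3 K ι₁) (σ : K →+* ℂ),
      (Model.picardCMUniverse exists_isReal_hodgeModel_holds hodgePQ_independent_of_hodgeModel_holds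
        BallQuotient.ballQuotientUniformised_holds cmAbelianVarietyRealised_holds).PeriodNV ι₁ V K R₉.psi σ)
    {P A : AbelianVariety ℂ} (hP : AbelianVariety.IsProductOf (fun B : AbelianVariety ℂ =>
      ∃ (E : Type) (_ : Field E) (_ : NumberField E) (_ : IsCMField E) (_ : E →+* (K : Type)) (Φ : CMType E)
        (ι : 𝓞 E →+* End B) (θ : E →+* Module.End ℂ (complexBetti B.X 1)),
        IsCMTypeRealisation Φ B ι θ) P)
    (hA : AVDominatedBy A P) : HodgeConjectureFor A.dim A.X := by
  obtain ⟨e, hmul, he⟩ := FaceCensus.exists_enum_of_autEnum Γ σ₀ ε hε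
  have hconj : e conjT = Γ.conj := by rw [FaceCensus.conjT_eq_translate σ₀, ← hc, he, hεc]
  exact hodgeConjectureFor_of_avDominatedBy_isProductOf_of_facePeriod_tetradecicCyclic K e hmul hconj σ₀ R₁ R₂ R₃ R₄ R₅ R₆ R₇ R₈ R₉
    (FaceCensus.reads_of_autEnum Γ e σ₀ ε he R₁ hΦ₁ hp₁ hp₁' hq₁ hq₁')
    (FaceCensus.reads_of_autEnum Γ e σ₀ ε he R₂ hΦ₂ hp₂ hp₂' hq₂ hq₂')
    (FaceCensus.reads_of_autEnum Γ e σ₀ ε he R₃ hΦ₃ hp₃ hp₃' hq₃ hq₃')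
    (FaceCensus.reads_of_autEnum Γ e σ₀ ε he R₄ hΦ₄ hp₄ hp₄' hq₄ hq₄')
    (FaceCensus.reads_of_autEnum Γ e σ₀ ε he R₅ hΦ₅ hp₅ hp₅' hq₅ hq₅')
    (FaceCensus.reads_of_autEnum Γ e σ₀ ε he R₆ hΦ₆ hp₆ hp₆' hq₆ hq₆')
    (FaceCensus.reads_of_autEnum Γ e σ₀ ε he R₇ hΦ₇ hp₇ hp₇' hq₇ hq₇')
    (FaceCensus.reads_of_autEnum Γ e σ₀ ε he R₈ hΦ₈ hp₈ hp₈' hq₈ hq₈')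
    (FaceCensus.reads_of_autEnum Γ e σ₀ ε he R₉ hΦ₉ hp₉ hp₉' hq₉ hq₉')
    h₁ h₂ h₃ h₄ h₅ h₆ h₇ h₈ h₉ hP hA

end Summit.HodgeConjecture.CorCM.TetradecicFaceTransport.Cyclic

end
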